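import Mathlib
import HarnessLib
import HarnessLib.Audit
import Summits.AtomisticToContinuum.Statement

/-!
Route: BECHeatBathTensorisation

CLOSED (retired) 2026-08-15T14:55:29Z by operator:999:1754322 — reason: not-a-thesis: assembly does not conclude the sub-problem Statement — note: D-0027 §2.1 audit (human 2026-08-15: routes that do not decide the summit are removed): the assembly concludes `Literature.MathematicalPhysics.QuantumManyBody.BoseGas.BoseEinsteinCondensation`, not the sub-problem statement; a NEW conforming route may be opened from the same idea (generated `closes . The file is kept as the record of this route; refuted decls are indexed as negative knowledge (`ledger negatives`).

# Route BECHeatBathTensorisation — λ_max deficit ≤ heat-bath relaxation time of |Ψ_N|² ×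
single-particle influence sum, mode-free

It suffices to show X = ParticleTensorisation ∧ SquareSummableInfluence (card
glauber-tensorisation-depletion, items A1 ∧ A2,
recast in a MODE-FREE Dirichlet frame). For any unit N-body state Θ and any (N+1)-body state Ψ in
the same box put
m(y) = ⟨Θ, Ψ(y,·)⟩; then λ_max(γ_Ψ) ≥ (N+1)‖m‖² (removal bound, shared item DirichletRemovalBound)
and
1 − ‖m‖² = ∫dy min_c ‖Ψ(y,·) − cΘ‖² ≤ C_AT(Θ) · I(Θ,Ψ), where C_AT(Θ) is the
approximate-tensorisation constant of the
Born measure |Θ|² over PARTICLE LABELS (= inverse spectral gap of the heat-bath Gibbs sampler that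
deletes a particle and
re-inserts it from its conditional law) and I(Θ,Ψ) = Σ_i inf_g ‖Ψ − g_i(y, X without x_i)·Θ(X)‖² is
the total squared
influence of single bath particles on the insertion amplitude. ParticleTensorisation: C_AT = O(1)
uniformly in N and
ρ < ρ₀ for (a near-minimiser witnessing) the Dirichlet N-body ground state. SquareSummableInfluence:
I = o(1) as ρ → 0,
uniformly in N. Then λ_max ≥ (3/4)(N+1) for some near-minimiser at every slack, and fixed-N phase
rigidity (shared crux
GroundStateRigidity) makes it ≥ (3/8)(N+1) for all near-minimisers, i.e. HasGroundStateBEC with c =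
3/8.
Lean: `ParticleTensorisation ∧ SquareSummableInfluence`

## Assembly
Pure logic (theorem assembly_holds in Sketch.lean, rc 0): TensorisedIncrement turns A1, A2 and the
removal bound into
SomeNearMinimiserCondenses (λ_max ≥ (3/4)(N+1) for a near-minimiser at every slack); WitnessToBEC
feeds it through
NearMinimiserStability (from GroundStateRigidity at index N+1) and le_condensateNumber to
HasGroundStateBEC v ρ with
c = 3/8 for every ρ < ρ₀, i.e. the conjunct. Term: fun h1 h2 h3 h4 h5 h6 h7 => h7 (h4 h1 h2 h3) h5
h6.

Rationale: WHY THIS LINE. The positivity/landscape routes (BECPalmLandscape, BECSwapAffinity,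
BECConditionalEntropy) must bound the VARIANCE OF A
CORRELATED SUM — the insertion cost Σ_j u_eff(y − x_j) — which is finite only through hyperuniform
cancellations
(S(k) ≲ kξ) of the true ground state; BECRecoilCorrector bounds the same insertion amplitude h =
Ψ_{N+1}/Θ_N by
Kipnis–Varadhan correctors of the ground-state diffusion, whose gap closes like c/L. Here the
Efron–Stein/approximate-
tensorisation inequality Var ≤ C_AT Σ_i E Var_i (EfronStein1981, CaputoMenzTetali2016; the
"spectral-gap method" of
stochastic homogenisation, GloriaOtto2011, GloriaNeukammOtto2014; heat-bath gaps for continuum Gibbs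
measures, Bertini2002,
Wu2004, Wu2006, KondratievKunaOhlerich2013, MichelenPerkins2022, HelmuthPerkinsPetti2022) is
imported from MCMC/functional
inequalities and applied to |Θ_N|² over particle labels: the cross terms disappear by construction
(I has no pair
correlations, no structure factor), and the whole many-body content sits in ONE number, the
relaxation time of a
fictitious sampler that relocates particles across the box in a single move and is therefore blind
to the kinetic gap
π²/L². New w.r.t. the card: the mode-free removal bound makes the y-term of the audit's circularity
caution vanish
identically (no torus, no translation invariance, no BoundaryTransferWeak), and the near-minimiser
typing is
needle-proofed (existential witness for A1 — the universal form is false by locally dominant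
microscopic bumps —,
L²-continuous universal form for A2, rigidity shared).

RANKED CRUXES. #0 Target (target) — X = ParticleTensorisation ∧ SquareSummableInfluence (A1 ∧ A2 of
the card, Dirichlet mode-free frame). (why it might fail: A1 carries the whole weight (audit-12): no
functional inequality for |Ψ₀|² of an interacting Bose gas is known; in d = 1 (Tonks, λ_max ≈
1.54√N) the route's own inequality forces C_AT·I ≥ 1 − O(N^{-1/2}), so the pair (A1, A2) is
genuinely dimension-dependent.) [LiebSeiringerSolovejYngvason2005, PenroseOnsager1956,
EfronStein1981, Literature.Barriers.AtomisticToContinuum.OneDimensionalHardCore]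
#2 ParticleTensorisation (crux) — (card A1, Dirichlet, division-free) for every repulsive
finite-range v there are ρ₀ > 0 and C such that for 0 < ρ < ρ₀ and all large N, at EVERY slack δ > 0
SOME δ-near-minimiser Θ of the Dirichlet N-body energy in the box of side ((N+1)/ρ)^{1/3} satisfies
approximate tensorisation of variance over particle labels with constant C: for all bounded
measurable F : Λ^N → ℂ and all bounded measurable predictors g_i not depending on x_i, min_c ∫_{Λ^N}
|F − cΘ|² ≤ C Σ_i ∫_{Λ^N} |F − g_i Θ|² (for Θ > 0 a.e. this is Var_{Θ²}(f) ≤ C Σ_i E_{Θ²} Var(f |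
x_j, j ≠ i), f = F/Θ, i.e. heat-bath spectral gap ≥ 1/C); existential in Θ because near-minimisers
at fixed δ may carry locally dominant microscopic bumps that trap the sampler. [difficulty:
open-problem] (why it might fail: Uncharted: C uniform in L although the one-particle TV influence
is ℓ¹-divergent (r⁻² phonon tail, Dobrushin row sums ~L/ξ): Wu/Dobrushin fail, Holley–Stroock is
useless (extensive log-density errors), Bauerschmidt–Bodineau needs explicit Gibbs structure; one
slow nonlinear collective mode kills it.) [Bertini2002, Wu2006, Wu2004, BauerschmidtBodineau2019,
CaputoMenzTetali2016, KondratievKunaOhlerich2013, MichelenPerkins2022, HelmuthPerkinsPetti2022,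
GloriaNeukammOtto2014, EfronStein1981]
#3 SquareSummableInfluence (crux) — (card A2, Dirichlet) for every repulsive finite-range v and
every ε > 0 there is ρ₀ > 0 such that for 0 < ρ < ρ₀ and all large N there is δ₂ > 0 with: for EVERY
δ₂-near-minimiser Θ of the N-body Dirichlet energy in the box of side ((N+1)/ρ)^{1/3} and every δ >
0, SOME δ-near-minimiser Ψ of the (N+1)-body energy in the same box admits bounded measurable
predictors g_i(y, X without x_i) with Σ_i ∫_{Λ^{N+1}} |Ψ(y,X) − g_i(y,X)Θ(X)|² ≤ ε — the total
squared single-bath-particle resampling influence on the insertion amplitude is o(1) (heuristically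
≈ 5√(ρa³): core + a/r part up to ξ + Reatto–Chester r⁻² tail, each square-integrable in d = 3;
universal in Θ is safe because I is L²-continuous, given rigidity). [difficulty: XL] (why it might
fail: Needs the DRESSED decay of the y–x_i correlation in Ψ_{N+1}/Θ_N: with the undressed a/r tail
out to L the sum is ~ρa²L → ∞; square-summability is the Reatto–Chester r⁻² law for the TRUE ground
state, where the T = 0 infrared lives; universal-in-Θ typing presupposes fixed-N phase rigidity.)
[ReattoChester1967, Reatto1969, PenroseOnsager1956, LiebSeiringerSolovejYngvason2005,
Literature.Barriers.AtomisticToContinuum.BogoliubovPerturbationInfrared]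
#4 GroundStateRigidity (crux) — (shared item stmt-AtomisticToContinuum-3298, verbatim) L² phase
rigidity of Dirichlet near-minimisers at fixed N: ∀ v ∃ρ₀ ∀ρ<ρ₀ ∀ᶠN ∀η>0 ∃δ>0, any two
δ-near-minimisers Ψ, Φ ∈ TrialState N L (L = (N/ρ)^{1/3}) satisfy ∫|Ψ − cΦ|² ≤ η for some unit c ∈
ℂ; used at index N+1 to pass from the good witness Ψ_δ to all near-minimisers
(NearMinimiserStability). [difficulty: M] (why it might fail: Hard cores (v = ⊤ on [0,R₀]) are
admissible: the hard-sphere configuration space in Λ_L can be disconnected (box-spanning jammed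
sheets have positive measure once N ≫ (L/R₀)²); uniqueness needs the dilute component to carry a
strict minimum — not in print.) [ReedSimonIV1978, LiebSeiringerSolovejYngvason2005,
doi:10.1093/imrn/rnt012, route-AtomisticToContinuum-BECPalmLandscape]
#9 TensorisedIncrement (support) — (card A3, the glue) ParticleTensorisation →
SquareSummableInfluence → DirichletRemovalBound → SomeNearMinimiserCondenses. Proof: with C from A1
take ε = 1/(4C) in A2; for large N take δ₂ (A2), the witness Θ* of A1 at slack δ₂, and for each δ
the witness Ψ_δ of A2; apply A1 fibrewise to F_y = Ψ_δ(y,·), g_{y,i} = g_i(y,·) (update-invariance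
via Function.update of vecCons), compare with the projection c_y = m(y) = ∫conjΘ*·Ψ_δ(y,·)
(∫|Ψ_δ(y,·)|² − |m(y)|² ≤ ∫|Ψ_δ(y,·) − c_yΘ*|² since ∫|Θ*|² = 1), integrate over y (Tonelli; vecCons
is measure-preserving): 1 − ∫|m|² ≤ Cε = 1/4; DirichletRemovalBound gives maxOccupation (N+1) Ψ_δ ≥
(N+1)∫|m|² ≥ (3/4)(N+1). Lean-heavy (Fin.cons/vecCons measurable equivalence, lintegral ↔ Bochner),
mathematically routine. [difficulty: L] [EfronStein1981, PenroseOnsager1956]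
#9 SomeNearMinimiserCondenses (support) — (intermediate node, the route's λ_max statement before
rigidity) for every repulsive finite-range v there is ρ₀ > 0 such that for 0 < ρ < ρ₀ there is c > 0
with: for all large N and every δ > 0 SOME δ-near-minimiser Ψ of the (N+1)-body Dirichlet energy in
the box of side ((N+1)/ρ)^{1/3} has λ_max(γ_Ψ) = maxOccupation ≥ c(N+1). [difficulty: open-problem]
[PenroseOnsager1956, LiebSeiringerSolovejYngvason2005]
#9 WitnessToBEC (support) — (frame) SomeNearMinimiserCondenses → NearMinimiserStability →
GroundStateRigidity → BoseEinsteinCondensation: instantiate stability at index N+1 with m =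
ofReal(c(N+1)) to get δ > 0 with maxOccupation ≥ m/2 for every δ-near-minimiser, then
le_condensateNumber and the index shift ∀ᶠ N ↦ N+1 give HasGroundStateBEC v ρ with constant c/2, ρ₀
= min of the three thresholds. [difficulty: provable-now] [LiebSeiringerSolovejYngvason2005,
PenroseOnsager1956]
#9 DirichletRemovalBound (support) — (shared item stmt-AtomisticToContinuum-4389, verbatim)
mode-free removal bound in any box: (N+1)∫|g(y)|²dy ≤ maxOccupation (N+1) Φ with g(y) = ∫ conj Θ(X)
Φ(y,X) dX, for Dirichlet trial states Φ (N+1 bodies) and Θ (N bodies); proof: test maxOccupation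
with φ = g/‖g‖ and Cauchy–Schwarz against Θ. [difficulty: M] [PenroseOnsager1956,
LiebSeiringerSolovejYngvason2005]
#9 NearMinimiserStability (support) — (shared item stmt-AtomisticToContinuum-3984, verbatim)
GroundStateRigidity → for every v, small ρ and all large N: if for every δ > 0 SOME δ-near-minimiser
has maxOccupation ≥ m, then for some δ > 0 EVERY δ-near-minimiser has maxOccupation ≥ m/2 (rigidity
+ √N-Lipschitz OccupationStability, item 3300). [difficulty: provable-now]
[LiebSeiringerSolovejYngvason2005, route-AtomisticToContinuum-BECPalmLandscape]
#9 JastrowDobrushinRung (support) — (card A4, classical rung, theorem-candidate de-risking the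
engine and its typing) for 0 ≤ f ≤ 1 even measurable with 1 − f² integrable and 5N∫_{ℝ³}(1 − f²) ≤
L³, the Jastrow law ∝ ∏_{i<j} f(x_i − x_j)² dX on Λ_L^N satisfies approximate tensorisation over
particles with constant 2: min_c ∫|F − c|²P ≤ 2 Σ_i ∫|F − g_i|²P (heat-bath gap ≥ 1/2). Proof
sketch: the TV-Dobrushin influence of x_j on the conditional law of x_i is ≤ 2∫(1−f²)/((1−α)L³), α =
N∫(1−f²)/L³ ≤ 1/5, so row sums r ≤ 2α/(1−α) ≤ 1/2; oscillation contraction of the continuous-time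
Gibbs sampler (d/dt Σ_kδ_k(P_tF) ≤ −(1−r)Σ_kδ_k) gives gap ≥ 1 − r (Dobrushin–Shlosman; Wu2006). By
the route's inequality it re-proves BEC for Reatto's Jastrow states without cluster expansions.
[difficulty: M] [Wu2006, doi:10.1007/978-1-4899-6653-7_20, HoudebertZass2022, Reatto1969,
Bertini2002]

TWO-LAYER PLAN. Foreseen glued splits (k ≤ 3, depth 1), filed only after a crux moves:
ParticleTensorisation ⇐ LocalBlockAT (AT for observables of O(1) particles at scale ξ: Dobrushin
regime, the
JastrowDobrushinRung mechanism, row sum of the ξ-healed pair factor = 4πρaξ² = 1/2) →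
CollectiveBlockAT (AT for the
collective linear statistics ρ_k, |k| ≤ 1/ξ: Var/ΣE Var_i = S(k) ≤ 1, and for the positive-definite
quadratic tail via
the Bauerschmidt–Bodineau covariance decomposition) → a block-factorisation glue à la
CaputoMenzTetali2016
(Var ≤ C(local block + collective block)).
SquareSummableInfluence ⇐ PairInfluenceReduction (I ≤ ρ∫(1 − f_eff)² + a three-body remainder) →
DressedPairTail
(1 − f_eff ∈ L²(ℝ³) uniformly in N: the Reatto–Chester r⁻² law for the true ground state) → glue.
A TORUS TWIN of the whole line (translation-invariant witnesses kill the y-term; output PeriodicBEC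
= item 0826 and the
insertion residue 4385 of BECRecoilCorrector, then BoundaryTransferWeak 0827) is available but
deliberately not filed:
the mode-free Dirichlet frame needs neither the constant mode nor the boundary-condition transfer.

KILL CRITERIA. ¬ParticleTensorisation for some admissible v at arbitrarily small ρ (no C works: a
heat-bath mode whose relaxation time
grows with L for every near-minimiser family) closes the route — `close --reason
refuted:ParticleTensorisation` — and the
slow mode is handed to the landscape routes as a structural fact about |Ψ₀|².
¬SquareSummableInfluence (I ≥ const
uniformly: undressed tail) forces ONE pivot: dressed predictors (let g_i see x_i through a fixed
pair factor f(y − x_i),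
"dressed tensorisation", restating A1/A2 together); if that is refuted too, close.
¬GroundStateRigidity (hard-core
degeneracy) ⇒ restate every item for locally bounded v (the hard-core conjunct then needs another
route). BEC or
PeriodicBEC (0826) proved elsewhere moots the route; a proof of InsertionResidue (4385) does not
(torus, other engine)
but makes SomeNearMinimiserCondenses' torus twin free.

NOT DECOMPOSED YET. Constants (C, ε = 1/(4C), c = 3/4 → 3/8) and the measure-theoretic lemmas of
TensorisedIncrement (vecCons as a
measure-preserving equivalence, lintegral/Bochner Cauchy–Schwarz) — provers attach them with
--supports. The torus twin
(above). The d = 1 autopsy (Tonks: A2 fails there — the influence of each particle on ∏_j|sin π(y −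
x_j)/L| is O(1) at
every distance, I_N ~ N; whether A1 ALSO fails in d = 1 is open: the card's number-rigidity
heuristic (Ghosh–Peres ⇒
E Var_i = 0) does not survive scrutiny, since rigid processes still have non-degenerate one-point
conditional laws) is
left to refuters as a consistency exercise, not an item. Entropy/MLSI versions (exponential
concentration of the
landscape; stronger than needed) and the grand-canonical birth–death variant (Bertini2002 setting)
are not filed.

CHEAPEST FALSIFIER. (i) RUN here by hand (passes): the card's fastest refutation (i), the Gaussian
collective toy measure
∝ exp(−(1/2V)Σ_{|k|<1/ξ} ũ(k)|ρ_k|²)∏dx_j with ρũ(k) = 1/S(k) − 1 ~ 1/(kξ): the linearised heat-bath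
drift of ρ_k is
−(1 + ρũ(k))ρ_k = −ρ_k/S(k), relaxation RATE ≥ 1 per unit resampling time for every k (hyperuniform
modes relax faster,
not slower), and the linearisation is justified because the one-particle landscape W_j has Var W_j ~
√(ρa³) ≪ 1; so
C_AT(toy) = 1: no linear slow mode exists. (ii) The cheapest real kill, not runnable in this seat:
VMC with the LHY-healed
Jastrow state at ρa³ = 10⁻³, N = 64…512 — estimate I_N (resample one particle by heat-bath
Metropolis, record the
squared relative change of ∏_j f(y − x_j)) and the integrated autocorrelation time of Σ_j u_eff(y −
x_j) under heat-bath
sweeps; a linear drift in L of either number kills A2 resp. A1. (iii) Literature kill for A1: any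
lower bound growing
with N on the mixing time of single-particle global-move samplers for 3D hard-sphere/Jastrow
measures at fixed low
density — none found; the printed results go the other way (O(N log N) mixing at low density,
HelmuthPerkinsPetti2022;
volume-uniform gap, Bertini2002).

NUMBERS. Healing length ξ = (8πρa)^{-1/2}; Dobrushin row sum of the ξ-healed pair factor ρ∫(1 − f²)
≈ 4πρaξ² = 1/2 (ρ-independent);
of the r⁻² tail out to L: ~ L/ξ (divergent — why A1 is not Dobrushin). Heuristic influence sum I ≈
ρ(4π/3)a³ + 4πρa²ξ +
4πρa²ξ ≈ 2√(2π)√(ρa³) ≈ 5.0√(ρa³): 0.05 at ρa³ = 10⁻⁴, 0.005 at ρa³ = 10⁻⁶; the assembly needs C_AT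
≤ 1/(4I), i.e.
C_AT ≤ 5 resp. 50. Consistency floor: Bogoliubov depletion (8/(3√π))√(ρa³) ≈ 1.50√(ρa³) ≤ C_AT·I
forces C_AT ≥ 0.3.
d = 1 Tonks: λ_max ≈ 1.5427√N (OneDimensionalHardCore) ⇒ C_AT·I_N ≥ 1 − O(N^{-1/2}) there.
JastrowDobrushinRung:
α = N∫(1−f²)/L³ ≤ 1/5 ⇒ r ≤ 1/2 ⇒ C = 2. Items at open: 11 (3 cruxes, 1 target, 1 assembly, 6
support).

DEFINITION REQUESTS. None. Conditional variances / conditional expectations are avoided by the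
inf-over-predictors (g_i independent of x_i via
Function.update) and the division-free weighting by Θ; everything is stated over
Literature.MathematicalPhysics.QuantumManyBody.BoseGas.{TrialState, energy, groundStateEnergy, boxN,
maxOccupation, sideLength, IsRepulsiveFiniteRange, BoseEinsteinCondensation} (lean search --decl:
all present in BoseEinsteinCondensation.lean); Sketch.lean rc 0.

Novelty: Searches (2026-08-15): `lit search --source crossref` ×7 ("spectral gap Glauber dynamics continuous
gas" → Bertini2002, LuYau1993, KondratievKunaOhlerich2013, Wu2004, GloriaNeukammOtto2014,
JainPhamVuong 2022; "Poincaré inequality Gibbs measures Dobrushin uniqueness" → Wu2006,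
Dobrushin–Shlosman 1985, HoudebertZass2022, BetschLast2023; "approximate tensorization of entropy
Caputo Menz Tetali" → CaputoMenzTetali2016; "Bauerschmidt Bodineau LSI high temperature" →
BauerschmidtBodineau2019; "rigidity tolerance point processes Ghosh Peres" → GhoshPeres2017; "Reatto
Chester phonons Bose" → ReattoChester1967; "Bose-Einstein condensation condensate depletion spectral
gap Markov chain Poincaré wave function measure" and "Efron-Stein influence variance ground state
bosons Jastrow" → 0 relevant rows); `lit search --hybrid --source local` (textbooks only:
Griffin1993, PethickSmith2008, Binder1992 p.259); `lit galaxy search --star all` ×3 ("approximate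
tensorization of variance" → 4 pdf rows: localization-schemes lecture notes,
Efthymiou–Hayes–Štefankovič–Vigoda tensorization on trees, HDX concentration — none physical;
"spectral gap Glauber dynamics continuous gas", "spectral gap for Glauber type dynamics" → 0) +
`--star pdf` "continuum Glauber dynamics" → 0; `lit frontier AtomisticToContinuum --since 2021` (30
rows; nearest: arXiv:2510.20493 ChongLiangNam2026 kinetic localisation via Poincaré-type
inequalities — kinetic-gap class, not a sampler gap; arXiv:2603.20776 Junge2026); `lit br  [refs: 10.1016/s0246-0203(01, 10.1214/009117906000000368:, 10.1007/s00222-014-0518-z:, 2510.20493, 2603.20776, doi:10.1016/s0246-0203, doi:10.1214/009117906000000368, doi:10.1007/s00222-014-0518-z, Bertini2002, LuYau1993, KondratievKunaOhlerich2013, Wu2004, GloriaNeukammOtto2014, Wu2006, HoudebertZass2022, CaputoMenzTetali2016, BauerschmidtBodineau2019, GhoshPeres2017, ReattoChester1967, Griffin1993, Cho]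

Barriers (technique_class: tensorisation, heat-bath-gap, ground-state-measure): - technique_class: tensorisation, heat-bath-gap, ground-state-measure
- Literature.Barriers.AtomisticToContinuum.PitaevskiiStringariOneDimension: RESPECTED, the line is
not dimension-blind: for the d = 1 Tonks gas λ_max ≈ 1.54√N, so by the route's own inequality
C_AT·I_N ≥ 1 − O(N^{-1/2}); concretely A2 FAILS in d = 1 (each particle's influence on the insertion
amplitude ∏_j|sin π(y−x_j)/L| is O(1) at every distance, I_N ~ N), while in d = 3 A2 rests on
square-integrability of the dressed r⁻² influence — an infrared use of d = 3, which is what the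
narrowed entry says an evasion must use.
- Literature.Barriers.AtomisticToContinuum.PitaevskiiStringariOneDimensionNarrow: same evasion
against the narrowed wording — no f-sum rule or compressibility input is used; the d-dependence
enters through the L²(ℝ^d)-summability of one dressed influence function (fails in d = 1, holds in d
= 3).
- Literature.Barriers.AtomisticToContinuum.OneDimensionalHardCore: consistent and used as the d = 1
autopsy (Numbers); it constrains nothing in d = 3.
- Literature.Barriers.AtomisticToContinuum.KineticGapLengthScales: EVADED — the only gap in the
route is that of the fictitious heat-bath sampler on |Θ|², which relocates a particle across the
whole box in one move and is REQUIRED uniform in L (that requirement is crux A1, openly); nothing is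
multiplied by L², and the kinetic gap π²/L² enters only qualitatively, at fixed N, inside
GroundStateRigidity (δ chosen after N).
- Literature.Barriers.AtomisticT

History (route lifecycle, newest last):
- 2026-08-15T12:58:03Z · rev 2: restated Target (stmt-AtomisticToContinuum-7522) — render fix 1/2: Target was BLOCKED (forward reference to ParticleTensorisation/SquareSummableInfluence rendered below it); restate with the two bodies inlined, (planner-plancard-AtomisticToContinuum-BoseEin-0cdec678-0)
- 2026-08-15T12:58:25Z · rev 3: restated TensorisedIncrement (stmt-AtomisticToContinuum-7525) — render fix 2/2: TensorisedIncrement was BLOCKED (forward reference to SomeNearMinimiserCondenses rendered below it); restate with that body inlined; Assembly (l (planner-plancard-AtomisticToContinuum-BoseEin-0cdec678-0)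
- 2026-08-15T12:59:19Z · rev 4: restated Assembly (stmt-AtomisticToContinuum-7529) — render fix 3/3: re-issue the Assembly (hypotheses reordered, cruxes first; same content) so that it is ordered after the restated TensorisedIncrement (8535) and (planner-plancard-AtomisticToContinuum-BoseEin-0cdec678-0)
- 2026-08-15T13:38:45Z · CLOSED retired — not-a-thesis: assembly does not conclude the sub-problem Statement (operator:999:1257524)
- 2026-08-15T14:55:29Z · CLOSED retired — not-a-thesis: assembly does not conclude the sub-problem Statement (operator:999:1754322)

sub-problem: BoseEinsteinCondensation · status: closed(retired) · opened planner-plancard-AtomisticToContinuum-BoseEin-0cdec678-0 2026-08-15T12:11:15Z · rev 4 · ledger route-AtomisticToContinuum-BECHeatBathTensorisation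
GENERATED by the gate from the ledger (D-0016/17). Provers cite these decls: `theorem foo : Summit.AtomisticToContinuum.BoseEinsteinCondensation.Theses.BECHeatBathTensorisation.<Decl> := …` in Summits/AtomisticToContinuum/BoseEinsteinCondensation/Theorems/<Name>.lean.
-/

namespace Summit.AtomisticToContinuum.BoseEinsteinCondensation.Theses.BECHeatBathTensorisation

open scoped BigOperators Topology Manifold Classical MeasureTheory ProbabilityTheory Matrix InnerProductSpace ComplexConjugate ContinuousMap
open Filter Set Function TopologicalSpace MeasureTheory

attribute [summit_statement] _root_.BoseEinsteinCondensation

-- earlier Target (stmt-AtomisticToContinuum-7522, replaced 2026-08-15T12:58:03Z -> stmt-AtomisticToContinuum-8534): retired by None — ParticleTensorisation ∧ SquareSummableInfluence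
/-- item stmt-AtomisticToContinuum-8534 · target · rank 0 · closed · moot by None · by planner
why it might fail: A1 carries the whole weight (audit-12): no functional inequality for |Ψ₀|² of an interacting Bose gas is known; in d = 1 (Tonks, λ_max ≈ 1.54√N) the route's own inequality forces C_AT·I ≥ 1 − O(N^{-1/2}), so the pair (A1, A2) is genuinely dimension-dependent.
sources: LiebSeiringerSolovejYngvason2005, PenroseOnsager1956, EfronStein1981, Literature.Barriers.AtomisticToContinuum.OneDimensionalHardCore
[target] X = ParticleTensorisation ∧ SquareSummableInfluence (A1 ∧ A2 of card
glauber-tensorisation-depletion, Dirichlet mode-free frame), written with both bodies INLINED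
because the file renders items in order and the short-name conjunction placed first could not see
the two crux decls (definitionally the same Prop; Sketch2.lean: Target ↔ ParticleTensorisation ∧
SquareSummableInfluence := Iff.rfl, rc 0). -/
@[route_item "route-AtomisticToContinuum-BECHeatBathTensorisation"]
def Target : Prop :=
  (∀ v : ℝ → ENNReal, Literature.MathematicalPhysics.QuantumManyBody.BoseGas.IsRepulsiveFiniteRange v → ∃ ρ₀ : ℝ, 0 < ρ₀ ∧ ∃ C : ℝ, 0 < C ∧ ∀ ρ : ℝ, 0 < ρ → ρ < ρ₀ → ∀ᶠ N : ℕ in Filter.atTop, ∀ δ : ENNReal, 0 < δ → ∃ Θ : Literature.MathematicalPhysics.QuantumManyBody.BoseGas.TrialState N (Literature.MathematicalPhysics.QuantumManyBody.BoseGas.sideLength ρ (N + 1)), Literature.MathematicalPhysics.QuantumManyBody.BoseGas.energy v Θ ≤ Literature.MathematicalPhysics.QuantumManyBody.BoseGas.groundStateEnergy v N (Literature.MathematicalPhysics.QuantumManyBody.BoseGas.sideLength ρ (N + 1)) + δ ∧ ∀ (F : (Fin N → EuclideanSpace ℝ (Fin 3)) → ℂ) (g : Fin N → (Fin N → EuclideanSpace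 ℝ (Fin 3)) → ℂ), Measurable F → (∀ i, Measurable (g i)) → (∃ M : ℝ, ∀ X, ‖F X‖ ≤ M ∧ ∀ i, ‖g i X‖ ≤ M) → (∀ i X x, g i (Function.update X i x) = g i X) → ∃ c : ℂ, (∫⁻ X in Literature.MathematicalPhysics.QuantumManyBody.BoseGas.boxN N (Literature.MathematicalPhysics.QuantumManyBody.BoseGas.sideLength ρ (N + 1)), (‖F X - c * Θ.ψ X‖₊ : ENNReal) ^ 2) ≤ ENNReal.ofReal C * ∑ i : Fin N, ∫⁻ X in Literature.MathematicalPhysics.QuantumManyBody.BoseGas.boxN N (Literature.MathematicalPhysics.QuantumManyBody.BoseGas.sideLength ρ (N + 1)), (‖F X - g i X * Θ.ψ X‖₊ : ENNReal) ^ 2) ∧ (∀ v : ℝ → ENNReal, Literature.MathematicalPhysics.QuantumManyBody.BoseGas.IsRepulsiveFiniteRange v → ∀ ε : ℝ, 0 < ε → ∃ ρ₀ : ℝ, 0 < ρ₀ ∧ ∀ ρ : ℝ, 0 < ρ → ρ < ρ₀ → ∀ᶠ N : ℕ in Filter.atTop, ∃ δ₂ : ENNReal, 0 < δ₂ ∧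 ∀ Θ : Literature.MathematicalPhysics.QuantumManyBody.BoseGas.TrialState N (Literature.MathematicalPhysics.QuantumManyBody.BoseGas.sideLength ρ (N + 1)), Literature.MathematicalPhysics.QuantumManyBody.BoseGas.energy v Θ ≤ Literature.MathematicalPhysics.QuantumManyBody.BoseGas.groundStateEnergy v N (Literature.MathematicalPhysics.QuantumManyBody.BoseGas.sideLength ρ (N + 1)) + δ₂ → ∀ δ : ENNReal, 0 < δ → ∃ Ψ : Literature.MathematicalPhysics.QuantumManyBody.BoseGas.TrialState (N + 1) (Literature.MathematicalPhysics.QuantumManyBody.BoseGas.sideLength ρ (N + 1)), Literature.MathematicalPhysics.QuantumManyBody.BoseGas.energy v Ψ ≤ Literature.MathematicalPhysics.QuantumManyBody.BoseGas.groundStateEnergy v (N + 1) (Literature.MathematicalPhysics.QuantumManyBody.BoseGas.sideLength ρ (N + 1)) + δ ∧ ∃ g : Fin N → (Fin (N + 1) → EuclideanSpace ℝ (Fin 3)) → ℂ, (∀ i, Measurable (g i)) ∧ (∃ M : ℝ, ∀ i Z, ‖g i Z‖ ≤ M) ∧ (∀ i Z x, g i (Function.update Z (Fin.succ i) x) = g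 i Z) ∧ (∑ i : Fin N, ∫⁻ Z in Literature.MathematicalPhysics.QuantumManyBody.BoseGas.boxN (N + 1) (Literature.MathematicalPhysics.QuantumManyBody.BoseGas.sideLength ρ (N + 1)), (‖Ψ.ψ Z - g i Z * Θ.ψ (Matrix.vecTail Z)‖₊ : ENNReal) ^ 2) ≤ ENNReal.ofReal ε)

/-- item stmt-AtomisticToContinuum-7523 · crux · rank 2 · closed · moot by None · by planner
why it might fail: Uncharted: C uniform in L although the one-particle TV influence is ℓ¹-divergent (r⁻² phonon tail, Dobrushin row sums ~L/ξ): Wu/Dobrushin fail, Holley–Stroock is useless (extensive log-density errors), Bauerschmidt–Bodineau needs explicit Gibbs structure; one slow nonlinear collective mode kills it.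
sources: Bertini2002, Wu2006, Wu2004, BauerschmidtBodineau2019, CaputoMenzTetali2016, KondratievKunaOhlerich2013
[crux] (card A1, Dirichlet, division-free) for every repulsive finite-range v there are ρ₀ > 0 and C
such that for 0 < ρ < ρ₀ and all large N, at EVERY slack δ > 0 SOME δ-near-minimiser Θ of the
Dirichlet N-body energy in the box of side ((N+1)/ρ)^{1/3} satisfies approximate tensorisation of
variance over particle labels with constant C: for all bounded measurable F : Λ^N → ℂ and all
bounded measurable predictors g_i not depending on x_i, min_c ∫_{Λ^N} |F − cΘ|² ≤ C Σ_i ∫_{Λ^N} |F −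
g_i Θ|² (for Θ > 0 a.e. this is Var_{Θ²}(f) ≤ C Σ_i E_{Θ²} Var(f | x_j, j ≠ i), f = F/Θ, i.e.
heat-bath spectral gap ≥ 1/C); existential in Θ because near-minimisers at fixed δ may carry locally
dominant microscopic bumps that trap the sampler. [difficulty: open-problem] -/
@[route_item "route-AtomisticToContinuum-BECHeatBathTensorisation"]
def ParticleTensorisation : Prop :=
  ∀ v : ℝ → ENNReal, Literature.MathematicalPhysics.QuantumManyBody.BoseGas.IsRepulsiveFiniteRange v → ∃ ρ₀ : ℝ, 0 < ρ₀ ∧ ∃ C : ℝ, 0 < C ∧ ∀ ρ : ℝ, 0 < ρ → ρ < ρ₀ → ∀ᶠ N : ℕ in Filter.atTop, ∀ δ : ENNReal, 0 < δ → ∃ Θ : Literature.MathematicalPhysics.QuantumManyBody.BoseGas.TrialState N (Literature.MathematicalPhysics.QuantumManyBody.BoseGas.sideLength ρ (N + 1)), Literature.MathematicalPhysics.QuantumManyBody.BoseGas.energy v Θ ≤ Literature.MathematicalPhysics.QuantumManyBody.BoseGas.groundStateEnergy v N (Literature.MathematicalPhysics.QuantumManyBody.BoseGas.sideLength ρ (N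 + 1)) + δ ∧ ∀ (F : (Fin N → EuclideanSpace ℝ (Fin 3)) → ℂ) (g : Fin N → (Fin N → EuclideanSpace ℝ (Fin 3)) → ℂ), Measurable F → (∀ i, Measurable (g i)) → (∃ M : ℝ, ∀ X, ‖F X‖ ≤ M ∧ ∀ i, ‖g i X‖ ≤ M) → (∀ i X x, g i (Function.update X i x) = g i X) → ∃ c : ℂ, (∫⁻ X in Literature.MathematicalPhysics.QuantumManyBody.BoseGas.boxN N (Literature.MathematicalPhysics.QuantumManyBody.BoseGas.sideLength ρ (N + 1)), (‖F X - c * Θ.ψ X‖₊ : ENNReal) ^ 2) ≤ ENNReal.ofReal C * ∑ i : Fin N, ∫⁻ X in Literature.MathematicalPhysics.QuantumManyBody.BoseGas.boxN N (Literature.MathematicalPhysics.QuantumManyBody.BoseGas.sideLength ρ (N + 1)), (‖F X - g i X * Θ.ψ X‖₊ : ENNReal) ^ 2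

/-- item stmt-AtomisticToContinuum-7524 · crux · rank 3 · closed · moot by None · by planner
why it might fail: Needs the DRESSED decay of the y–x_i correlation in Ψ_{N+1}/Θ_N: with the undressed a/r tail out to L the sum is ~ρa²L → ∞; square-summability is the Reatto–Chester r⁻² law for the TRUE ground state, where the T = 0 infrared lives; universal-in-Θ typing presupposes fixed-N phase rigidity.
sources: ReattoChester1967, Reatto1969, PenroseOnsager1956, LiebSeiringerSolovejYngvason2005, Literature.Barriers.AtomisticToContinuum.BogoliubovPerturbationInfrared
[crux] (card A2, Dirichlet) for every repulsive finite-range v and every ε > 0 there is ρ₀ > 0 such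
that for 0 < ρ < ρ₀ and all large N there is δ₂ > 0 with: for EVERY δ₂-near-minimiser Θ of the
N-body Dirichlet energy in the box of side ((N+1)/ρ)^{1/3} and every δ > 0, SOME δ-near-minimiser Ψ
of the (N+1)-body energy in the same box admits bounded measurable predictors g_i(y, X without x_i)
with Σ_i ∫_{Λ^{N+1}} |Ψ(y,X) − g_i(y,X)Θ(X)|² ≤ ε — the total squared single-bath-particle
resampling influence on the insertion amplitude is o(1) (heuristically ≈ 5√(ρa³): core + a/r part up
to ξ + Reatto–Chester r⁻² tail, each square-integrable in d = 3; universal in Θ is safe because I is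
L²-continuous, given rigidity). [difficulty: XL] -/
@[route_item "route-AtomisticToContinuum-BECHeatBathTensorisation"]
def SquareSummableInfluence : Prop :=
  ∀ v : ℝ → ENNReal, Literature.MathematicalPhysics.QuantumManyBody.BoseGas.IsRepulsiveFiniteRange v → ∀ ε : ℝ, 0 < ε → ∃ ρ₀ : ℝ, 0 < ρ₀ ∧ ∀ ρ : ℝ, 0 < ρ → ρ < ρ₀ → ∀ᶠ N : ℕ in Filter.atTop, ∃ δ₂ : ENNReal, 0 < δ₂ ∧ ∀ Θ : Literature.MathematicalPhysics.QuantumManyBody.BoseGas.TrialState N (Literature.MathematicalPhysics.QuantumManyBody.BoseGas.sideLength ρ (N + 1)), Literature.MathematicalPhysics.QuantumManyBody.BoseGas.energy v Θ ≤ Literature.MathematicalPhysics.QuantumManyBody.BoseGas.groundStateEnergy v N (Literature.MathematicalPhysics.QuantumManyBody.BoseGas.sideLength ρ (N + 1)) + δ₂ → ∀ δ : ENNReal, 0 < δ → ∃ Ψ : Literature.MathematicalPhysics.QuantumManyBody.BoseGas.TrialState (N + 1) (Literature.MathematicalPhysics.QuantumManyBody.BoseGas.sideLength ρ (N + 1)),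 Literature.MathematicalPhysics.QuantumManyBody.BoseGas.energy v Ψ ≤ Literature.MathematicalPhysics.QuantumManyBody.BoseGas.groundStateEnergy v (N + 1) (Literature.MathematicalPhysics.QuantumManyBody.BoseGas.sideLength ρ (N + 1)) + δ ∧ ∃ g : Fin N → (Fin (N + 1) → EuclideanSpace ℝ (Fin 3)) → ℂ, (∀ i, Measurable (g i)) ∧ (∃ M : ℝ, ∀ i Z, ‖g i Z‖ ≤ M) ∧ (∀ i Z x, g i (Function.update Z (Fin.succ i) x) = g i Z) ∧ (∑ i : Fin N, ∫⁻ Z in Literature.MathematicalPhysics.QuantumManyBody.BoseGas.boxN (N + 1) (Literature.MathematicalPhysics.QuantumManyBody.BoseGas.sideLength ρ (N + 1)), (‖Ψ.ψ Z - g i Z * Θ.ψ (Matrix.vecTail Z)‖₊ : ENNReal) ^ 2) ≤ ENNReal.ofReal ε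

/-- item stmt-AtomisticToContinuum-3298 · crux · rank 4 · closed · moot by None · by planner
why it might fail: Hard cores (v = ⊤ on [0,R₀]) are admissible: the hard-sphere configuration space in Λ_L can be disconnected (box-spanning jammed sheets have positive measure once N ≫ (L/R₀)²); uniqueness needs the dilute component to carry a strict minimum — not in print.
sources: ReedSimonIV1978, LiebSeiringerSolovejYngvason2005, doi:10.1093/imrn/rnt012, route-AtomisticToContinuum-BECPalmLandscape
[crux] card item A2 (phase rigidity): ∀ admissible v ∃ρ₀ ∀ρ<ρ₀ ∀ᶠ N ∀η>0 ∃δ>0: any two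
δ-near-minimisers Ψ, Φ ∈ TrialState N L (L = (N/ρ)^(1/3)) satisfy ∫|Ψ − cΦ|² ≤ η for some unit
complex c (E₀ < ∞, compact resolvent, unique positive ground state and spectral gap of the Dirichlet
N-body problem at fixed N; for hard cores via connectedness / energetic dominance of the dilute
component of the hard-sphere configuration space). [difficulty: M] -/
@[route_item "route-AtomisticToContinuum-BECHeatBathTensorisation"]
def GroundStateRigidity : Prop :=
  ∀ v : ℝ → ENNReal, Literature.MathematicalPhysics.QuantumManyBody.BoseGas.IsRepulsiveFiniteRange v → ∃ ρ₀ : ℝ, 0 < ρ₀ ∧ ∀ ρ : ℝ, 0 < ρ → ρ < ρ₀ → ∀ᶠ N : ℕ in Filter.atTop, ∀ η : ℝ, 0 < η → ∃ δ : ENNReal, 0 < δ ∧ ∀ Ψ Φ : Literature.MathematicalPhysics.QuantumManyBody.BoseGas.TrialState N (Literature.MathematicalPhysics.QuantumManyBody.BoseGas.sideLength ρ N), Literature.MathematicalPhysics.QuantumManyBody.BoseGas.energy v Ψ ≤ Literature.MathematicalPhysics.QuantumManyBody.BoseGas.groundStateEnergy v N (Literature.MathematicalPhysics.QuantumManyBody.BoseGas.sideLength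 ρ N) + δ → Literature.MathematicalPhysics.QuantumManyBody.BoseGas.energy v Φ ≤ Literature.MathematicalPhysics.QuantumManyBody.BoseGas.groundStateEnergy v N (Literature.MathematicalPhysics.QuantumManyBody.BoseGas.sideLength ρ N) + δ → ∃ c : ℂ, ‖c‖ = 1 ∧ ∫⁻ X, (‖Ψ.ψ X - c * Φ.ψ X‖₊ : ENNReal) ^ 2 ≤ ENNReal.ofReal η

/-- item stmt-AtomisticToContinuum-3984 · support · rank 9 · closed · moot by None · by planner
sources: LiebSeiringerSolovejYngvason2005, route-AtomisticToContinuum-BECPalmLandscape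
[support] (the form of the transfer the frame uses) GroundStateRigidity → for every v, small ρ and
all large N: if for every δ > 0 SOME δ-near-minimiser has maxOccupation ≥ m, then for some δ > 0
EVERY δ-near-minimiser has maxOccupation ≥ m/2. Proof from rigidity with η ~ (m/(8N))² and the
√N-Lipschitz bound maxOccupation(Ψ)^(1/2) ≤ maxOccupation(Φ)^(1/2) + √N‖Ψ − cΦ‖₂ (sup over modes of
item stmt-AtomisticToContinuum-3300 OccupationStability of route BECPalmLandscape); m ≤ N is forced
by the hypothesis. [difficulty: provable-now] -/
@[route_item "route-AtomisticToContinuum-BECHeatBathTensorisation"]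
def NearMinimiserStability : Prop :=
  GroundStateRigidity → (∀ v : ℝ → ENNReal, Literature.MathematicalPhysics.QuantumManyBody.BoseGas.IsRepulsiveFiniteRange v → ∃ ρ₀ : ℝ, 0 < ρ₀ ∧ ∀ ρ : ℝ, 0 < ρ → ρ < ρ₀ → ∀ᶠ N : ℕ in Filter.atTop, ∀ m : ENNReal, (∀ δ : ENNReal, 0 < δ → ∃ Ψ : Literature.MathematicalPhysics.QuantumManyBody.BoseGas.TrialState N (Literature.MathematicalPhysics.QuantumManyBody.BoseGas.sideLength ρ N), Literature.MathematicalPhysics.QuantumManyBody.BoseGas.energy v Ψ ≤ Literature.MathematicalPhysics.QuantumManyBody.BoseGas.groundStateEnergy v N (Literature.MathematicalPhysics.QuantumManyBody.BoseGas.sideLength ρ N) + δ ∧ m ≤ Literature.MathematicalPhysics.QuantumManyBody.BoseGas.maxOccupation N Ψ.ψ) → ∃ δ : ENNReal, 0 < δ ∧ ∀ Ψ : Literature.MathematicalPhysics.QuantumManyBody.BoseGas.TrialState N (Literature.MathematicalPhysics.QuantumManyBody.BoseGas.sideLength ρ N), Literature.MathematicalPhysics.QuantumManyBody.BoseGas.energy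 v Ψ ≤ Literature.MathematicalPhysics.QuantumManyBody.BoseGas.groundStateEnergy v N (Literature.MathematicalPhysics.QuantumManyBody.BoseGas.sideLength ρ N) + δ → m / 2 ≤ Literature.MathematicalPhysics.QuantumManyBody.BoseGas.maxOccupation N Ψ.ψ)

/-- item stmt-AtomisticToContinuum-4389 · support · rank 9 · closed · moot by None · by planner
sources: PenroseOnsager1956, LiebSeiringerSolovejYngvason2005
[support] mode-free removal bound in ANY box (operator inequality γ_Φ ≥ (N+1)|g⟩⟨g|, g(y) = ∫ conj
Θ(X) Φ(y,X) dX for every normalised N-body Θ): (N+1)∫|g(y)|²dy ≤ maxOccupation (N+1) Φ for Dirichlet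
trial states Φ (N+1 bodies) and Θ (N bodies); proof: if g ≠ 0 test maxOccupation with φ = g/‖g‖ and
apply Cauchy–Schwarz against Θ in the remaining variables. It is the transfer-free criterion for the
Dirichlet rerun of the line (fallback if BoundaryTransferWeak dies) and serves the insertion/swap
family of cards. [difficulty: M] -/
@[route_item "route-AtomisticToContinuum-BECHeatBathTensorisation"]
def DirichletRemovalBound : Prop :=
  ∀ (N : ℕ) (L : ℝ) (Φ : Literature.MathematicalPhysics.QuantumManyBody.BoseGas.TrialState (N + 1) L) (Θ : Literature.MathematicalPhysics.QuantumManyBody.BoseGas.TrialState N L), ((N : ENNReal) + 1) * ∫⁻ y, (‖∫ X, conj (Θ.ψ X) * Φ.ψ (Matrix.vecCons y X)‖₊ : ENNReal) ^ 2 ≤ Literature.MathematicalPhysics.QuantumManyBody.BoseGas.maxOccupation (N + 1) Φ.ψ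

/-- item stmt-AtomisticToContinuum-7526 · support · rank 9 · closed · moot by None · by planner
sources: PenroseOnsager1956, LiebSeiringerSolovejYngvason2005
[support] (intermediate node, the route's λ_max statement before rigidity) for every repulsive
finite-range v there is ρ₀ > 0 such that for 0 < ρ < ρ₀ there is c > 0 with: for all large N and
every δ > 0 SOME δ-near-minimiser Ψ of the (N+1)-body Dirichlet energy in the box of side
((N+1)/ρ)^{1/3} has λ_max(γ_Ψ) = maxOccupation ≥ c(N+1). [difficulty: open-problem] -/
@[route_item "route-AtomisticToContinuum-BECHeatBathTensorisation"]
def SomeNearMinimiserCondenses : Prop :=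
  ∀ v : ℝ → ENNReal, Literature.MathematicalPhysics.QuantumManyBody.BoseGas.IsRepulsiveFiniteRange v → ∃ ρ₀ : ℝ, 0 < ρ₀ ∧ ∀ ρ : ℝ, 0 < ρ → ρ < ρ₀ → ∃ c : ℝ, 0 < c ∧ ∀ᶠ N : ℕ in Filter.atTop, ∀ δ : ENNReal, 0 < δ → ∃ Ψ : Literature.MathematicalPhysics.QuantumManyBody.BoseGas.TrialState (N + 1) (Literature.MathematicalPhysics.QuantumManyBody.BoseGas.sideLength ρ (N + 1)), Literature.MathematicalPhysics.QuantumManyBody.BoseGas.energy v Ψ ≤ Literature.MathematicalPhysics.QuantumManyBody.BoseGas.groundStateEnergy v (N + 1) (Literature.MathematicalPhysics.QuantumManyBody.BoseGas.sideLength ρ (N + 1)) + δ ∧ ENNReal.ofReal (c * (N + 1)) ≤ Literature.MathematicalPhysics.QuantumManyBody.BoseGas.maxOccupation (N + 1) Ψ.ψ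

/-- item stmt-AtomisticToContinuum-7527 · support · rank 9 · closed · moot by None · by planner
sources: LiebSeiringerSolovejYngvason2005, PenroseOnsager1956
[support] (frame) SomeNearMinimiserCondenses → NearMinimiserStability → GroundStateRigidity →
BoseEinsteinCondensation: instantiate stability at index N+1 with m = ofReal(c(N+1)) to get δ > 0
with maxOccupation ≥ m/2 for every δ-near-minimiser, then le_condensateNumber and the index shift ∀ᶠ
N ↦ N+1 give HasGroundStateBEC v ρ with constant c/2, ρ₀ = min of the three thresholds. [difficulty:
provable-now] -/
@[route_item "route-AtomisticToContinuum-BECHeatBathTensorisation"]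
def WitnessToBEC : Prop :=
  SomeNearMinimiserCondenses → NearMinimiserStability → GroundStateRigidity → Literature.MathematicalPhysics.QuantumManyBody.BoseGas.BoseEinsteinCondensation

/-- item stmt-AtomisticToContinuum-7528 · support · rank 9 · closed · moot by None · by planner
sources: Wu2006, doi:10.1007/978-1-4899-6653-7_20, HoudebertZass2022, Reatto1969, Bertini2002
[support] (card A4, classical rung, theorem-candidate de-risking the engine and its typing) for 0 ≤
f ≤ 1 even measurable with 1 − f² integrable and 5N∫_{ℝ³}(1 − f²) ≤ L³, the Jastrow law ∝ ∏_{i<j}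
f(x_i − x_j)² dX on Λ_L^N satisfies approximate tensorisation over particles with constant 2: min_c
∫|F − c|²P ≤ 2 Σ_i ∫|F − g_i|²P (heat-bath gap ≥ 1/2). Proof sketch: the TV-Dobrushin influence of
x_j on the conditional law of x_i is ≤ 2∫(1−f²)/((1−α)L³), α = N∫(1−f²)/L³ ≤ 1/5, so row sums r ≤
2α/(1−α) ≤ 1/2; oscillation contraction of the continuous-time Gibbs sampler (d/dt Σ_kδ_k(P_tF) ≤
−(1−r)Σ_kδ_k) gives gap ≥ 1 − r (Dobrushin–Shlosman; Wu2006). By the route's inequality it re-proves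
BEC for Reatto's Jastrow states without cluster expansions. [difficulty: M] -/
@[route_item "route-AtomisticToContinuum-BECHeatBathTensorisation"]
def JastrowDobrushinRung : Prop :=
  ∀ (N : ℕ) (L : ℝ), 0 < L → ∀ f : EuclideanSpace ℝ (Fin 3) → ℝ, Measurable f → (∀ x, 0 ≤ f x ∧ f x ≤ 1) → (∀ x, f (-x) = f x) → MeasureTheory.Integrable (fun x => 1 - f x ^ 2) → 5 * (N : ℝ) * (∫ x, (1 - f x ^ 2)) ≤ L ^ 3 → ∀ (F : (Fin N → EuclideanSpace ℝ (Fin 3)) → ℂ) (g : Fin N → (Fin N → EuclideanSpace ℝ (Fin 3)) → ℂ), Measurable F → (∀ i, Measurable (g i)) → (∃ M : ℝ, ∀ X, ‖F X‖ ≤ M ∧ ∀ i, ‖g i X‖ ≤ M) → (∀ i X x, g i (Function.update X i x) = g i X) → ∃ c : ℂ, (∫⁻ X in Literature.MathematicalPhysics.QuantumManyBody.BoseGas.boxN N L, (‖F X - c‖₊ : ENNReal) ^ 2 * ENNReal.ofReal (∏ i : Fin N, ∏ j ∈ Finset.univ.filter (fun j => i < j), f (X i - X j) ^ 2)) ≤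 2 * ∑ i : Fin N, ∫⁻ X in Literature.MathematicalPhysics.QuantumManyBody.BoseGas.boxN N L, (‖F X - g i X‖₊ : ENNReal) ^ 2 * ENNReal.ofReal (∏ i : Fin N, ∏ j ∈ Finset.univ.filter (fun j => i < j), f (X i - X j) ^ 2)

-- earlier TensorisedIncrement (stmt-AtomisticToContinuum-7525, replaced 2026-08-15T12:58:25Z -> stmt-AtomisticToContinuum-8535): retired by None — ParticleTensorisation → SquareSummableInfluence → DirichletRemovalBound → SomeNearMinimiserCondenses
/-- item stmt-AtomisticToContinuum-8535 · support · rank 9 · closed · moot by None · by planner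
sources: EfronStein1981, PenroseOnsager1956
[support] (card A3, the glue) ParticleTensorisation → SquareSummableInfluence →
DirichletRemovalBound → SomeNearMinimiserCondenses, with the conclusion SomeNearMinimiserCondenses
INLINED (that decl is rendered below this item; definitionally the same Prop, Sketch2.lean rc 0
incl. the assembly term). Proof: ε = 1/(4C); Θ* from A1 at slack δ₂ of A2; for each δ the witness
Ψ_δ of A2; A1 fibrewise in y to F_y = Ψ_δ(y,·), g_{y,i} = g_i(y,·); projection c_y = m(y) =
∫conjΘ*·Ψ_δ(y,·); Tonelli over y: 1 − ∫|m|² ≤ Cε = 1/4; DirichletRemovalBound: maxOccupation ≥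
(N+1)∫|m|² ≥ (3/4)(N+1). [difficulty: L] -/
@[route_item "route-AtomisticToContinuum-BECHeatBathTensorisation"]
def TensorisedIncrement : Prop :=
  ParticleTensorisation → SquareSummableInfluence → DirichletRemovalBound → ∀ v : ℝ → ENNReal, Literature.MathematicalPhysics.QuantumManyBody.BoseGas.IsRepulsiveFiniteRange v → ∃ ρ₀ : ℝ, 0 < ρ₀ ∧ ∀ ρ : ℝ, 0 < ρ → ρ < ρ₀ → ∃ c : ℝ, 0 < c ∧ ∀ᶠ N : ℕ in Filter.atTop, ∀ δ : ENNReal, 0 < δ → ∃ Ψ : Literature.MathematicalPhysics.QuantumManyBody.BoseGas.TrialState (N + 1) (Literature.MathematicalPhysics.QuantumManyBody.BoseGas.sideLength ρ (N + 1)), Literature.MathematicalPhysics.QuantumManyBody.BoseGas.energy v Ψ ≤ Literature.MathematicalPhysics.QuantumManyBody.BoseGas.groundStateEnergy v (N + 1) (Literature.MathematicalPhysics.QuantumManyBody.BoseGas.sideLength ρ (N + 1)) + δ ∧ ENNReal.ofReal (c * (N + 1)) ≤ Literature.MathematicalPhysics.QuantumManyBody.BoseGas.maxOccupation (N + 1)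 Ψ.ψ

-- earlier Assembly (stmt-AtomisticToContinuum-7529, replaced 2026-08-15T12:59:19Z -> stmt-AtomisticToContinuum-8540): retired by None — ParticleTensorisation → SquareSummableInfluence → DirichletRemovalBound → TensorisedIncrement → NearMinimiserStability → GroundStateRigidity → WitnessToBEC → Literature.MathematicalPhysics.QuantumManyBody.BoseGas.BoseEinsteinCondensation
/-- item stmt-AtomisticToContinuum-8540 · assembly · rank 1 · closed · moot by None · by planner
sources: PenroseOnsager1956, LiebSeiringerSolovejYngvason2005
[assembly] ParticleTensorisation → SquareSummableInfluence → GroundStateRigidity →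
DirichletRemovalBound → TensorisedIncrement → NearMinimiserStability → WitnessToBEC →
BoseEinsteinCondensation (the three cruxes first, then the support chain); pure logic: fun h1 h2 h6
h3 h4 h5 h7 => h7 (h4 h1 h2 h3) h5 h6 (Sketch2.lean rc 0). -/
@[route_item "route-AtomisticToContinuum-BECHeatBathTensorisation"]
def Assembly : Prop :=
  ParticleTensorisation → SquareSummableInfluence → GroundStateRigidity → DirichletRemovalBound → TensorisedIncrement → NearMinimiserStability → WitnessToBEC → Literature.MathematicalPhysics.QuantumManyBody.BoseGas.BoseEinsteinCondensation

end Summit.AtomisticToContinuum.BoseEinsteinCondensation.Theses.BECHeatBathTensorisation
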